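import Mathlib

/-!
# `ExactCertificate` (stmt-AtomisticToContinuum-11959), line `closure-makes-nogap-exact`,
# Transfer1D skeleton (`Cruxes.ExactCertificate.Transfer1D.ExactCertificate1D`): stub `stub_cesaro`

Support file for the crux `ThreeConeCertificate.ExactCertificate` (crux 11959), line
`closure-makes-nogap-exact`, TRANSFER skeleton `ExactCertificate1D` (the `d = 1` exact Lennard-Jones
certificate), wave 2 (its energetic corollary `HasPeriodicGroundStateEnergy lennardJones 1`).
This file proves the registered stub `stub_cesaro`, a piece of pure real analysis
(Cesàro / Fejér means): for a summable real sequence `e`,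

  `(1/N) Σ_{d<N} (N − d) e_d = Σ_{d<N} (1 − d/N) e_d ⟶ Σ_d e_d`  as `N → ∞`.

It is used twice downstream: with `e_d = V(d a)` it identifies the limiting energy per particle of
`N` equally spaced Lennard-Jones particles, and with `e_d = c_d + c_{-d}` it is the Fejér-mean
convergence inside the periodic Bochner inequality.

Proof: the Abel/Fejér resummation `Σ_{d<N} (N − d) e_d = Σ_{n<N} Σ_{d≤n} e_d` (induction on `N`)
turns the weighted mean into the Cesàro mean of the shifted partial sums `n ↦ Σ_{d≤n} e_d`, which
converge to `Σ' e`; Mathlib's `Filter.Tendsto.cesaro` finishes.  All `[folklore]`.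
-/

noncomputable section

namespace Summit.AtomisticToContinuum.Crystallization.Theorems.ThreeConeCertificateExactCertificate.Transfer1D

open Filter Topology

/-- Abel/Fejér resummation: `Σ_{d<N} (N − d) e_d = Σ_{n<N} Σ_{d≤n} e_d`. -/
theorem cesaro_sum_range_sub_mul (e : ℕ → ℝ) (N : ℕ) :
    ∑ d ∈ Finset.range N, ((N : ℝ) - d) * e d =
      ∑ n ∈ Finset.range N, ∑ d ∈ Finset.range (n + 1), e d := by
  induction N with
  | zero => simp
  | succ N ih =>
    have h1 : ∑ d ∈ Finset.range (N + 1), (((N + 1 : ℕ) : ℝ) - d) * e d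
        = ∑ d ∈ Finset.range N, ((N : ℝ) - d) * e d + ∑ d ∈ Finset.range (N + 1), e d := by
      rw [Finset.sum_range_succ, Finset.sum_range_succ e, ← add_assoc, ← Finset.sum_add_distrib]
      congr 1
      · refine Finset.sum_congr rfl fun d _ => ?_
        push_cast
        ring
      · push_cast
        ring
    rw [h1, ih, Finset.sum_range_succ (fun n => ∑ d ∈ Finset.range (n + 1), e d) N]

/-- **Registered stub `stub_cesaro`** (Cesàro / Fejér means of a summable sequence): for a summable
real sequence `e`, `(1/N) Σ_{d<N} (N − d) e_d → Σ_d e_d` as `N → ∞`. -/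
theorem stub_cesaro : ∀ e : ℕ → ℝ, Summable e →
    Filter.Tendsto (fun N : ℕ => (∑ d ∈ Finset.range N, ((N : ℝ) - d) * e d) / N)
      Filter.atTop (nhds (∑' d : ℕ, e d)) := by
  intro e hs
  have hu : Tendsto (fun n : ℕ => ∑ d ∈ Finset.range (n + 1), e d) atTop (𝓝 (∑' d, e d)) :=
    hs.hasSum.tendsto_sum_nat.comp (tendsto_add_atTop_nat 1)
  refine Filter.Tendsto.congr (fun N => ?_) hu.cesaro
  rw [cesaro_sum_range_sub_mul, div_eq_inv_mul]

end Summit.AtomisticToContinuum.Crystallization.Theorems.ThreeConeCertificateExactCertificate.Transfer1D
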